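import Summits.Ventures.CertifiedManyBodySolver.Downfold.EmeryBoxesHg1223OPK26ThermalCapRetiltMarkovBoxp1
import Summits.Ventures.CertifiedManyBodySolver.Downfold.EmeryBoxesHg1223OPK26ThermalFloorAtlasWord
import Summits.Ventures.CertifiedManyBodySolver.Downfold.EmeryThermalAtomicFloor
import HarnessLib

/-!
# HIGH-TEMPERATURE-CLOSING `T > 0` WINDOW on HgBa2Ca2Cu3O8 (M35) OUTER plane U-SLICE «(K) 11o» (5.804, 4.762) — `emeryBoxHg1223OPK26` (router/EMERY-FLOOR-ORDERS row 22): the ATOMIC-LIMIT floor (full entropy) ∨ the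
# family floor, against the re-tilted cap — both sides meet at `6 log 2` as β → 0

Venture CertifiedManyBodySolver, cell `pub/hubbard-downfold` (S1 = ROUTER) × crew hubbard-fast S2 (ii) × (iv) «T > 0 × multi-band» (D-0096 (ii)); seat hubbard-downfold-mod-4
(S1/S2 Emery seam, g17). Namespace `Summit.Ventures.CertifiedManyBodySolver.Downfold`. DOOR: `EmeryThermalAtomicFloor` (`holdsOn_emeryCellPressureAtomicFloor`: Peierls on the
whole occupation basis of the `Cu₄O₈` block, site-wise factorisation; the one-site function is the tree's `atomicPartitionFnReal β U μ`). INPUTS BY NAME: the family floor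
`emeryBoxHg1223OPK26_pressureFloorFam_m39o5` (`EmeryBoxesHg1223OPK26ThermalFloorAtlasWord`; C = (-112.370382, -112.569800)), the cap `emeryBoxHg1223OPK26_pressureCap_m39o5_retilt` (`EmeryBoxesHg1223OPK26ThermalCapRetiltMarkovBoxp1`; `6 log 2 + 39.7962·β`; flat word 50.9962).
ATOMIC DATA: Cu at `μ_d = −(εp + Δ_hi) = 53/10`, `U_d,hi = 1451/250`; O at `μ_p = −εp = 39/5`, `U_p,hi = 2381/500` ⇒ classical slope 26.9760·β (family slope 28.1425; cap 39.7962).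
RESULT: **`emeryBoxHg1223OPK26_pressureWindowHighT_m39o5`**: `max(atomic, family) ≤ P_cell ≤ 6 log 2 + 39.7962·β` on the whole box, every β ≥ 0; width → 0 as β → 0 (both sides `6 log 2`,
`emeryBoxHg1223OPK26_pressure_beta_zero_m39o5`); crossover β* ≈ 0.908 (T* ≈ 12787 K) below which the atomic floor is the better floor [float].

Everything PROVED (0 sorry); no definition. HONEST FRAMING: CERTIFIED inequalities on a SCREENING/EXTRAPOLATED-grade object; the atomic floor ignores hopping (its slope sits
1.1664 below the family floor's), so at physical temperatures (β ≈ 20–40 eV⁻¹) the family floor still decides and thermal scales are NOT resolved there; what is new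
is the correct INFINITE-TEMPERATURE closure of the window and a certified high-T regime (β ≲ β*) with width `≈ 12.8202·β`; grand-canonical at the stated level; no phase word;
no router number moves. WHAT-THIS-IS-NOT: a new certificate (pure algebra on landed objects; zero kit).
-/

noncomputable section

namespace Summit.Ventures.CertifiedManyBodySolver.Downfold

open NonemptyInterval Matrix Finset Literature.Probability.LatticeModels
open Literature.MathematicalPhysics.QuantumLattice Literature.Computation.Certificates
open Summit.Ventures.CertifiedManyBodySolver.Certificates OccupationCode ClusterLowerBound
open scoped BigOperators ComplexOrder

/-! ## §1 The atomic-limit floor on the box at εp = -39/5 -/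

/-- **ATOMIC-LIMIT `T > 0` FLOOR** on the whole `emeryBoxHg1223OPK26`, cuprate signs, level εp = -39/5 (chemical potential 39/5 eV), EVERY β ≥ 0:
`log z₀(β; U_d = 1451/250, μ_d = 53/10) + 2·log z₀(β; U_p = 2381/500, μ_p = 39/5) ≤ P_cell` with `z₀(β; U, μ) = 1 + 2e^{βμ} + e^{−β(U−2μ)}` (`atomicPartitionFnReal`; Cu at the
box's upper level `εp + Δ_hi = -53/10` and `U_d,hi`, O at `εp` and `U_p,hi`). Value `6 log 2` at β = 0; slope `26.9760·β` as β → ∞ (classical minimum, no hopping).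
[cite: Ruelle1969, §2.5–2.6] [cite: Ueltschi1999, §3] -/
theorem emeryBoxHg1223OPK26_pressureAtomicFloor_m39o5 {β : ℝ} (hβ : 0 ≤ β) :
    HoldsOn (fun p : EmeryCoord → ℝ => Real.log (atomicPartitionFnReal β (1451/250 : ℝ) (53/10 : ℝ)) + 2 * Real.log (atomicPartitionFnReal β (2381/500 : ℝ) (39/5 : ℝ)) ≤ emeryCellPressure β (emeryLine cuprateSigns (emeryLineCoords (((-39/5 : ℚ)) : ℝ) p))) emeryBoxHg1223OPK26 := by
  intro p hp
  have h := holdsOn_emeryCellPressureAtomicFloor (E := emeryBoxHg1223OPK26) (eA := hg1223OPEmery_tpd) (eB := hg1223OPEmery_tpp) (eD := hg1223OPK26Emery_Delta) (eUd := hg1223OPK26Emery_Udd) (eUp := hg1223OPK26Emery_Upp) (-39/5) (by simp [emeryBoxHg1223OPK26, emeryBoxHg1223OPK26Src, Function.update]) (by simp [emeryBoxHg1223OPK26, emeryBoxHg1223OPK26Src, Function.update]) (Function.update_self _ _ _) (by simp [emeryBoxHg1223OPK26, emeryBoxHg1223OPK26Src, Function.update]) (by simp [emeryBoxHg1223OPK26,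 emeryBoxHg1223OPK26Src, Function.update]) cuprateSigns hβ p hp
  simp only [hg1223OPK26Emery_Delta, hg1223OPK26Emery_Udd, hg1223OPK26Emery_Upp, Entry.encl_ofEnds_snd] at h
  push_cast at h
  norm_num at h ⊢
  exact h

/-! ## §2 The best floor and the HIGH-TEMPERATURE-CLOSING window -/

/-- **BEST `T > 0` FLOOR = max(atomic, family)** on the whole box at εp = -39/5, every β ≥ 0: the atomic floor (full entropy, slope 26.9760) wins for
β < β* ≈ 0.908 (T > 12787 K), the family floor `emeryBoxHg1223OPK26_pressureFloorFam_m39o5` (slope 28.1425, entropy ¼·log 2) for β > β*. [cite: Ruelle1969, §2.5–2.6] [cite: Israel1979, Lemma II.3.1] -/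
theorem emeryBoxHg1223OPK26_pressureFloorBest_m39o5 {β : ℝ} (hβ : 0 ≤ β) :
    HoldsOn (fun p : EmeryCoord → ℝ => max (Real.log (atomicPartitionFnReal β (1451/250 : ℝ) (53/10 : ℝ)) + 2 * Real.log (atomicPartitionFnReal β (2381/500 : ℝ) (39/5 : ℝ))) (Real.log (Real.exp (-(β * (-56185191/500000 : ℝ))) + Real.exp (-(β * (-562849/5000 : ℝ)))) / 4) ≤ emeryCellPressure β (emeryLine cuprateSigns (emeryLineCoords (((-39/5 : ℚ)) : ℝ) p))) emeryBoxHg1223OPK26 :=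
  fun p hp => max_le (emeryBoxHg1223OPK26_pressureAtomicFloor_m39o5 hβ p hp) (emeryBoxHg1223OPK26_pressureFloorFam_m39o5 hβ p hp)

/-- **THE HIGH-TEMPERATURE-CLOSING TWO-SIDED `T > 0` WINDOW** (hypothesis-free on both sides) on the whole `emeryBoxHg1223OPK26`, level εp = -39/5, EVERY β ≥ 0:
`max(atomic, family) ≤ P_cell ≤ 6 log 2 + β·6367393/160000` (cap = `emeryBoxHg1223OPK26_pressureCap_m39o5_retilt`, hubbard-box-p1 re-tilted). BOTH SIDES EQUAL `6 log 2` AT β = 0; the width is `O(β)` for small β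
(slope gap 12.8202 against the atomic floor, 11.6538 against the family floor). Table [float; `T = 11604.5/β` K]:
| β (1/eV) | T (K) | atomic floor | family floor | best floor | cap | width |
|---|---|---|---|---|---|---|
| 0.01 | 1160450 | 4.3314 | 0.4545 | 4.3314 | 4.5568 | 0.2254 |
| 0.1 | 116045 | 6.0310 | 2.9851 | 6.0310 | 8.1385 | 2.1075 |
| 0.5 | 23209 | 15.2670 | 14.2324 | 15.2670 | 24.0570 | 8.7899 |
| 1 | 11604 | 28.1181 | 28.2921 | 28.2921 | 43.9551 | 15.6630 |
| 2 | 5802 | 54.8219 | 56.4133 | 56.4133 | 83.7513 | 27.3380 |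
| 5 | 2321 | 135.6126 | 140.7908 | 140.7908 | 203.1399 | 62.3492 |
| 10 | 1160 | 270.4564 | 281.4564 | 281.4564 | 402.1209 | 120.6645 |
| 20 | 580 | 540.2132 | 562.8536 | 562.8536 | 800.0830 | 237.2294 |
| 40 | 290 | 1079.7331 | 1125.6981 | 1125.6981 | 1596.0071 | 470.3090 |
[cite: Israel1979, Thm. I.2.4] [cite: Ruelle1969, §2.5–2.6] [cite: Ueltschi1999, §3] -/
theorem emeryBoxHg1223OPK26_pressureWindowHighT_m39o5 {β : ℝ} (hβ : 0 ≤ β) :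
    HoldsOn (fun p : EmeryCoord → ℝ =>
      max (Real.log (atomicPartitionFnReal β (1451/250 : ℝ) (53/10 : ℝ)) + 2 * Real.log (atomicPartitionFnReal β (2381/500 : ℝ) (39/5 : ℝ))) (Real.log (Real.exp (-(β * (-56185191/500000 : ℝ))) + Real.exp (-(β * (-562849/5000 : ℝ)))) / 4) ≤ emeryCellPressure β (emeryLine cuprateSigns (emeryLineCoords (((-39/5 : ℚ)) : ℝ) p)) ∧
      emeryCellPressure β (emeryLine cuprateSigns (emeryLineCoords (((-39/5 : ℚ)) : ℝ) p)) ≤ 6 * Real.log 2 + β * (6367393/160000 : ℝ)) emeryBoxHg1223OPK26 :=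
  fun p hp => ⟨emeryBoxHg1223OPK26_pressureFloorBest_m39o5 hβ p hp, by simpa using emeryBoxHg1223OPK26_pressureCap_m39o5_retilt hβ p hp⟩

/-- **At β = 0 the window is a point**: `P_cell(0, ·) = 6 log 2` on the whole box (floor and cap coincide). [cite: Ueltschi1999, §3] -/
theorem emeryBoxHg1223OPK26_pressure_beta_zero_m39o5 :
    HoldsOn (fun p : EmeryCoord → ℝ => emeryCellPressure 0 (emeryLine cuprateSigns (emeryLineCoords (((-39/5 : ℚ)) : ℝ) p)) = 6 * Real.log 2) emeryBoxHg1223OPK26 := by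
  intro p hp
  have h := emeryBoxHg1223OPK26_pressureWindowHighT_m39o5 le_rfl p hp
  rw [atomicPartitionFnReal_beta_zero, atomicPartitionFnReal_beta_zero, show (4 : ℝ) = 2 ^ 2 by norm_num, Real.log_pow] at h
  simp only [Nat.cast_ofNat, zero_mul, add_zero] at h
  have h1 := (le_max_left _ _).trans h.1
  linarith [h.2]

end Summit.Ventures.CertifiedManyBodySolver.Downfold

end
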